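import Mathlib
import HarnessLib
import Summits.NavierStokesRegularity.NavierStokesRegularity.Theorems.PoloidalWindowDoorLrcModEntireAxisKinematics

/-!
# Route `PoloidalWindowDoor`, item `LrcModEntire` (stmt-NavierStokesRegularity-20428) — AXIS KINEMATICS IV: the angular-harmonics
# lemma («apply `L` twice»): `α·U_w U_a + β·U_w + γ·U_{w′} = 0` with rotation-invariant coefficients forces `α·U_w U_a = 0`

Cell ns-regularity-ideate, seat ns-poloidal-K2-p3 gen 5 (LEAD of item 20428; file landed `--supports stmt-NavierStokesRegularity-20428` as a
helper).  Fourth kernel brick of AXIS-NOTE (step 4, extraction of the second harmonic WITHOUT trigonometric polynomials).  Notation: `c ∈ ℝ³`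
(only its horizontal part matters), `L f(y) := Df(y)[J(y − c)]`, and for a vector `p` the affine function `U_p(y) := (y₀ − c₀)p₀ + (y₁ − c₁)p₁`
(horizontal inner product with `y − c`); `J p := (−p₁, p₀, 0)` (`= rotGen p`).

* `fderiv_hdot_rotGen` — `L U_p = −U_{Jp}`; hence `L U_{Ja} = U_a` and `L² U_p = −U_p` for horizontal `p`;
* `angular_harmonics` — **if `α, β, γ` are differentiable on an open `O` with `Lα = Lβ = Lγ = 0` there, `w = Ja` (any `a, w′ ∈ ℝ³`; only horizontal parts enter), and `Φ := α·U_w·U_a + β·U_w + γ·U_{w′}` vanishes on `O`, then `α·U_w·U_a = 0` on `O`** (compute `LΦ` and `L(LΦ)` by the product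
  rule: `L²` acts as `−4` on `U_wU_a` and as `−1` on `U_w`, `U_{w′}`, so `Φ + L²Φ = −3α U_wU_a`);
* `eq_zero_of_mul_hdot_eq_zero` — **if moreover `a ≠ 0` (horizontally) and `α` is continuous on `O`, then `α = 0` on `O`** (the zero set of
  `U_wU_a` contains no open set: along the direction `a + w` both affine factors have slope `|a|²`).

In AXIS-NOTE, (★) `2∂_{Jc′}∂_zV + ∂_{Jc″}V = 0` for a per-plane radial `V = P(ρ², z)` is `Φ = 0` with `a = c′(z)`, `w′ = Jc″(z)`,
`α = −8P_rr`, `β = 4P_rz`, `γ = 2P_r` (all radial, hence `L`-invariant), so `c′(z) ≠ 0` forces `P_rr = 0`: a quadratic profile.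

WHAT THIS IS NOT: not a claim about Navier–Stokes regularity and not the axis lemma — planar calculus (bears_on LADDER-NS N0 via item 20428).
-/

noncomputable section

-- the summit and its single sub-problem share the name (CONVENTIONS §1), as in every Theorems file
set_option linter.dupNamespace false

namespace Summit.NavierStokesRegularity.NavierStokesRegularity.Theorems.PoloidalWindowDoorLrcModEntireAxisKinematics4

open Set Function Filter Topology Metric
open scoped RealInnerProductSpace InnerProductSpace
open Literature.Analysis Literature.Analysis.FluidPDE
open Summit.NavierStokesRegularity.NavierStokesRegularity.Theorems.PoloidalWindowDoorLrcModEntireAxisKinematics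

/-! ### The affine functions `U_p` and the generator `L` -/

/-- `U_p` is affine with derivative `v ↦ v₀ p₀ + v₁ p₁`. -/
theorem hasFDerivAt_hdot (c p y : EuclideanSpace ℝ (Fin 3)) :
    HasFDerivAt (fun y' : EuclideanSpace ℝ (Fin 3) => (y' 0 - c 0) * p 0 + (y' 1 - c 1) * p 1)
      (p 0 • (EuclideanSpace.proj (0 : Fin 3) : EuclideanSpace ℝ (Fin 3) →L[ℝ] ℝ) +
        p 1 • (EuclideanSpace.proj (1 : Fin 3) : EuclideanSpace ℝ (Fin 3) →L[ℝ] ℝ)) y := by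
  have h0 : HasFDerivAt (fun y' : EuclideanSpace ℝ (Fin 3) => y' 0 - c 0)
      (EuclideanSpace.proj (0 : Fin 3) : EuclideanSpace ℝ (Fin 3) →L[ℝ] ℝ) y :=
    (EuclideanSpace.proj (0 : Fin 3) : EuclideanSpace ℝ (Fin 3) →L[ℝ] ℝ).hasFDerivAt.sub_const _
  have h1 : HasFDerivAt (fun y' : EuclideanSpace ℝ (Fin 3) => y' 1 - c 1)
      (EuclideanSpace.proj (1 : Fin 3) : EuclideanSpace ℝ (Fin 3) →L[ℝ] ℝ) y :=
    (EuclideanSpace.proj (1 : Fin 3) : EuclideanSpace ℝ (Fin 3) →L[ℝ] ℝ).hasFDerivAt.sub_const _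
  have h := (h0.mul_const (p 0)).add (h1.mul_const (p 1))
  refine h.congr_fderiv ?_
  ext v
  simp

/-- `U_p` is differentiable. -/
theorem differentiableAt_hdot (c p y : EuclideanSpace ℝ (Fin 3)) :
    DifferentiableAt ℝ (fun y' : EuclideanSpace ℝ (Fin 3) => (y' 0 - c 0) * p 0 + (y' 1 - c 1) * p 1) y :=
  (hasFDerivAt_hdot c p y).differentiableAt

/-- **`L U_p = −U_{Jp}`**: `D U_p(y)[J(y − c)] = (y₀ − c₀) p₁ − (y₁ − c₁) p₀`. -/
theorem fderiv_hdot_rotGen (c p y : EuclideanSpace ℝ (Fin 3)) :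
    fderiv ℝ (fun y' : EuclideanSpace ℝ (Fin 3) => (y' 0 - c 0) * p 0 + (y' 1 - c 1) * p 1) y (rotGen (y - c)) =
      (y 0 - c 0) * p 1 - (y 1 - c 1) * p 0 := by
  rw [(hasFDerivAt_hdot c p y).fderiv]
  simp [rotGen]
  ring

/-! ### The angular-harmonics lemma -/

/-- **«Apply `L` twice».**  Let `O ⊆ ℝ³` be open; `α β γ : ℝ³ → ℝ` differentiable on `O` and annihilated there by the rotation generator
`L = D(·)[J(· − c)]`; `a, w′ ∈ ℝ³` (only their horizontal parts enter); `w := J a` (`w₀ = −a₁`, `w₁ = a₀`).  If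
`α(y)·U_w(y)·U_a(y) + β(y)·U_w(y) + γ(y)·U_{w′}(y) = 0` for all `y ∈ O` (`U_p(y) = (y₀−c₀)p₀ + (y₁−c₁)p₁`), then
`α(y)·U_w(y)·U_a(y) = 0` for all `y ∈ O`. -/
theorem angular_harmonics {α β γ : EuclideanSpace ℝ (Fin 3) → ℝ} {c a w' : EuclideanSpace ℝ (Fin 3)}
    {O : Set (EuclideanSpace ℝ (Fin 3))} (hO : IsOpen O)
    (hα : ∀ y ∈ O, DifferentiableAt ℝ α y) (hβ : ∀ y ∈ O, DifferentiableAt ℝ β y) (hγ : ∀ y ∈ O, DifferentiableAt ℝ γ y)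
    (hLα : ∀ y ∈ O, fderiv ℝ α y (rotGen (y - c)) = 0) (hLβ : ∀ y ∈ O, fderiv ℝ β y (rotGen (y - c)) = 0)
    (hLγ : ∀ y ∈ O, fderiv ℝ γ y (rotGen (y - c)) = 0)
    (hΦ : ∀ y ∈ O,
      α y * (((y 0 - c 0) * (-a 1) + (y 1 - c 1) * a 0) * ((y 0 - c 0) * a 0 + (y 1 - c 1) * a 1)) +
        β y * ((y 0 - c 0) * (-a 1) + (y 1 - c 1) * a 0) +
        γ y * ((y 0 - c 0) * w' 0 + (y 1 - c 1) * w' 1) = 0)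
    {y : EuclideanSpace ℝ (Fin 3)} (hy : y ∈ O) :
    α y * (((y 0 - c 0) * (-a 1) + (y 1 - c 1) * a 0) * ((y 0 - c 0) * a 0 + (y 1 - c 1) * a 1)) = 0 := by
  -- the affine functions
  set Uw : EuclideanSpace ℝ (Fin 3) → ℝ := fun y' => (y' 0 - c 0) * (-a 1) + (y' 1 - c 1) * a 0 with hUw
  set Ua : EuclideanSpace ℝ (Fin 3) → ℝ := fun y' => (y' 0 - c 0) * a 0 + (y' 1 - c 1) * a 1 with hUa
  set Uw' : EuclideanSpace ℝ (Fin 3) → ℝ := fun y' => (y' 0 - c 0) * w' 0 + (y' 1 - c 1) * w' 1 with hUw'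
  -- `J w'` as a vector
  set jw' : EuclideanSpace ℝ (Fin 3) := rotGen w' with hjw'
  set Ujw' : EuclideanSpace ℝ (Fin 3) → ℝ := fun y' => (y' 0 - c 0) * jw' 0 + (y' 1 - c 1) * jw' 1 with hUjw'
  -- `w` as a vector `(−a₁, a₀, a₂')`: we only use its first two coordinates through `Uw`
  set w : EuclideanSpace ℝ (Fin 3) := rotGen a with hw
  have hw0 : w 0 = -a 1 := rfl
  have hw1 : w 1 = a 0 := rfl
  have hUw_eq : Uw = fun y' => (y' 0 - c 0) * w 0 + (y' 1 - c 1) * w 1 := by rw [hw0, hw1]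
  -- `L` of the affine functions (pointwise, everywhere)
  have LUa : ∀ y', fderiv ℝ Ua y' (rotGen (y' - c)) = -Uw y' := by
    intro y'; rw [hUa, fderiv_hdot_rotGen]; simp only [hUw]; ring
  have LUw : ∀ y', fderiv ℝ Uw y' (rotGen (y' - c)) = Ua y' := by
    intro y'; rw [hUw_eq, fderiv_hdot_rotGen, hw0, hw1]; simp only [hUa]; ring
  have LUw' : ∀ y', fderiv ℝ Uw' y' (rotGen (y' - c)) = -Ujw' y' := by
    intro y'; rw [hUw', fderiv_hdot_rotGen]; simp only [hUjw', hjw', rotGen_apply_zero, rotGen_apply_one]; ring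
  have LUjw' : ∀ y', fderiv ℝ Ujw' y' (rotGen (y' - c)) = Uw' y' := by
    intro y'; rw [hUjw', fderiv_hdot_rotGen]; simp only [hUw', hjw', rotGen_apply_zero, rotGen_apply_one]; ring
  have dUa : ∀ y', DifferentiableAt ℝ Ua y' := fun y' => differentiableAt_hdot c a y'
  have dUw : ∀ y', DifferentiableAt ℝ Uw y' := fun y' => by rw [hUw_eq]; exact differentiableAt_hdot c w y'
  have dUw' : ∀ y', DifferentiableAt ℝ Uw' y' := fun y' => differentiableAt_hdot c w' y'
  have dUjw' : ∀ y', DifferentiableAt ℝ Ujw' y' := fun y' => differentiableAt_hdot c jw' y'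
  -- Φ, Φ₁ := LΦ, Φ₂ := LΦ₁
  set Φ : EuclideanSpace ℝ (Fin 3) → ℝ := fun y' => α y' * (Uw y' * Ua y') + β y' * Uw y' + γ y' * Uw' y' with hΦdef
  set Φ₁ : EuclideanSpace ℝ (Fin 3) → ℝ := fun y' => α y' * (Ua y' * Ua y' - Uw y' * Uw y') + β y' * Ua y' - γ y' * Ujw' y'
    with hΦ₁def
  set Φ₂ : EuclideanSpace ℝ (Fin 3) → ℝ := fun y' => -4 * (α y' * (Uw y' * Ua y')) - β y' * Uw y' - γ y' * Uw' y' with hΦ₂def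
  have hΦ0 : ∀ y' ∈ O, Φ y' = 0 := fun y' hy' => hΦ y' hy'
  -- L of a function vanishing on the open `O` vanishes on `O`
  have Lzero : ∀ {F : EuclideanSpace ℝ (Fin 3) → ℝ}, (∀ y' ∈ O, F y' = 0) → ∀ y' ∈ O, fderiv ℝ F y' (rotGen (y' - c)) = 0 := by
    intro F hF y' hy'
    have hev : F =ᶠ[𝓝 y'] fun _ => (0 : ℝ) := Filter.eventually_of_mem (hO.mem_nhds hy') fun z hz => hF z hz
    rw [hev.fderiv_eq, fderiv_fun_const]; rfl
  -- LΦ = Φ₁ on O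
  have hLΦ : ∀ y' ∈ O, fderiv ℝ Φ y' (rotGen (y' - c)) = Φ₁ y' := by
    intro y' hy'
    have dα := hα y' hy'; have dβ := hβ y' hy'; have dγ := hγ y' hy'
    have hD : HasFDerivAt Φ
        (α y' • (Uw y' • fderiv ℝ Ua y' + Ua y' • fderiv ℝ Uw y') + (Uw y' * Ua y') • fderiv ℝ α y' +
          (β y' • fderiv ℝ Uw y' + Uw y' • fderiv ℝ β y') +
          (γ y' • fderiv ℝ Uw' y' + Uw' y' • fderiv ℝ γ y')) y' := by
      rw [hΦdef]
      exact ((dα.hasFDerivAt.mul ((dUw y').hasFDerivAt.mul (dUa y').hasFDerivAt)).add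
        (dβ.hasFDerivAt.mul (dUw y').hasFDerivAt)).add (dγ.hasFDerivAt.mul (dUw' y').hasFDerivAt)
    rw [hD.fderiv]
    simp only [add_apply, smul_apply, smul_eq_mul, hLα y' hy', hLβ y' hy', hLγ y' hy', LUa, LUw, LUw']
    simp only [hΦ₁def]
    ring
  have hΦ₁0 : ∀ y' ∈ O, Φ₁ y' = 0 := fun y' hy' => by rw [← hLΦ y' hy']; exact Lzero hΦ0 y' hy'
  -- LΦ₁ = Φ₂ on O
  have hLΦ₁ : ∀ y' ∈ O, fderiv ℝ Φ₁ y' (rotGen (y' - c)) = Φ₂ y' := by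
    intro y' hy'
    have dα := hα y' hy'; have dβ := hβ y' hy'; have dγ := hγ y' hy'
    have hD : HasFDerivAt Φ₁
        (α y' • ((Ua y' • fderiv ℝ Ua y' + Ua y' • fderiv ℝ Ua y') - (Uw y' • fderiv ℝ Uw y' + Uw y' • fderiv ℝ Uw y')) +
            (Ua y' * Ua y' - Uw y' * Uw y') • fderiv ℝ α y' +
          (β y' • fderiv ℝ Ua y' + Ua y' • fderiv ℝ β y') -
          (γ y' • fderiv ℝ Ujw' y' + Ujw' y' • fderiv ℝ γ y')) y' := by
      rw [hΦ₁def]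
      exact ((dα.hasFDerivAt.mul (((dUa y').hasFDerivAt.mul (dUa y').hasFDerivAt).sub
        ((dUw y').hasFDerivAt.mul (dUw y').hasFDerivAt))).add
        (dβ.hasFDerivAt.mul (dUa y').hasFDerivAt)).sub (dγ.hasFDerivAt.mul (dUjw' y').hasFDerivAt)
    rw [hD.fderiv]
    simp only [add_apply, sub_apply, smul_apply, smul_eq_mul, hLα y' hy', hLβ y' hy', hLγ y' hy', LUa, LUw, LUjw']
    simp only [hΦ₂def]
    ring
  have hΦ₂0 : Φ₂ y = 0 := by rw [← hLΦ₁ y hy]; exact Lzero hΦ₁0 y hy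
  -- `Φ + Φ₂ = −3 α U_w U_a`
  have hsum : Φ y + Φ₂ y = -3 * (α y * (Uw y * Ua y)) := by
    simp only [hΦdef, hΦ₂def]; ring
  rw [hΦ0 y hy, hΦ₂0, zero_add] at hsum
  have h3 : α y * (Uw y * Ua y) = 0 := by linarith
  simpa [hUw, hUa] using h3

/-! ### Off the two exceptional lines, `α` vanishes -/

/-- **From `α·U_wU_a = 0` to `α = 0`.**  If `α` is continuous on the open `O`, `a` has a nonzero horizontal part, and
`α(y)·U_w(y)·U_a(y) = 0` on `O` (`w = Ja`), then `α = 0` on `O`: near every point of `O` there are points where both affine factors are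
nonzero (move along `a + w`, along which both have slope `a₀² + a₁²`), and `α` vanishes there. -/
theorem eq_zero_of_mul_hdot_eq_zero {α : EuclideanSpace ℝ (Fin 3) → ℝ} {c a : EuclideanSpace ℝ (Fin 3)}
    {O : Set (EuclideanSpace ℝ (Fin 3))} (hO : IsOpen O) (hαc : ContinuousOn α O) (ha : a 0 ≠ 0 ∨ a 1 ≠ 0)
    (h : ∀ y ∈ O, α y * (((y 0 - c 0) * (-a 1) + (y 1 - c 1) * a 0) * ((y 0 - c 0) * a 0 + (y 1 - c 1) * a 1)) = 0)
    {y : EuclideanSpace ℝ (Fin 3)} (hy : y ∈ O) : α y = 0 := by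
  -- the direction `v = a + Ja` (horizontal part) and the slope `s = a₀² + a₁² > 0`
  set s : ℝ := a 0 ^ 2 + a 1 ^ 2 with hs
  have hspos : 0 < s := by
    rcases ha with h0 | h1
    · have : 0 < a 0 ^ 2 := by positivity
      have : 0 ≤ a 1 ^ 2 := sq_nonneg _
      linarith
    · have : 0 < a 1 ^ 2 := by positivity
      have : 0 ≤ a 0 ^ 2 := sq_nonneg _
      linarith
  set v : EuclideanSpace ℝ (Fin 3) := (a 0 - a 1) • EuclideanSpace.single 0 (1 : ℝ) + (a 1 + a 0) • EuclideanSpace.single 1 (1 : ℝ)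
    with hv
  have hv0 : v 0 = a 0 - a 1 := by simp [hv]
  have hv1 : v 1 = a 1 + a 0 := by simp [hv]
  -- along `y + ε v` both factors are affine in `ε` with slope `s`
  set p : ℝ := (y 0 - c 0) * (-a 1) + (y 1 - c 1) * a 0 with hp
  set q : ℝ := (y 0 - c 0) * a 0 + (y 1 - c 1) * a 1 with hq
  have hline : ∀ ε : ℝ,
      ((y + ε • v) 0 - c 0) * (-a 1) + ((y + ε • v) 1 - c 1) * a 0 = p + ε * s ∧
      ((y + ε • v) 0 - c 0) * a 0 + ((y + ε • v) 1 - c 1) * a 1 = q + ε * s := by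
    intro ε
    constructor
    · simp only [PiLp.add_apply, PiLp.smul_apply, smul_eq_mul, hv0, hv1, hp, hs]; ring
    · simp only [PiLp.add_apply, PiLp.smul_apply, smul_eq_mul, hv0, hv1, hq, hs]; ring
  -- `α (y + ε v) = 0` for all small `ε` outside the two roots `−p/s`, `−q/s`
  have hαε : ∀ᶠ ε : ℝ in 𝓝[≠] 0, ε ≠ -p / s → ε ≠ -q / s → α (y + ε • v) = 0 := by
    have hcont : Tendsto (fun ε : ℝ => y + ε • v) (𝓝 0) (𝓝 y) := by
      have : Continuous (fun ε : ℝ => y + ε • v) := by fun_prop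
      simpa using this.tendsto 0
    have hmem : ∀ᶠ ε : ℝ in 𝓝 0, y + ε • v ∈ O := hcont (hO.mem_nhds hy)
    filter_upwards [nhdsWithin_le_nhds hmem] with ε hε hε1 hε2
    have hfac := h (y + ε • v) hε
    rw [(hline ε).1, (hline ε).2] at hfac
    have hne1 : p + ε * s ≠ 0 := by
      intro h0; apply hε1; field_simp; linarith
    have hne2 : q + ε * s ≠ 0 := by
      intro h0; apply hε2; field_simp; linarith
    rcases mul_eq_zero.1 hfac with hα0 | hprod
    · exact hα0
    · rcases mul_eq_zero.1 hprod with h1 | h2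
      · exact absurd h1 hne1
      · exact absurd h2 hne2
  -- the excluded values are avoided by all small nonzero ε except at most two points: pass to the limit ε → 0 along `𝓝[≠] 0`
  have hev : ∀ᶠ ε : ℝ in 𝓝[≠] 0, α (y + ε • v) = 0 := by
    -- points of `𝓝[≠] 0` different from the two (possibly zero) exceptional values
    have h1 : ∀ᶠ ε : ℝ in 𝓝[≠] 0, ε ≠ -p / s := by
      by_cases hps : -p / s = 0
      · rw [hps]; exact self_mem_nhdsWithin
      · exact nhdsWithin_le_nhds ((Filter.tendsto_id.eventually_ne (Ne.symm hps)).mono fun z hz => hz)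
    have h2 : ∀ᶠ ε : ℝ in 𝓝[≠] 0, ε ≠ -q / s := by
      by_cases hqs : -q / s = 0
      · rw [hqs]; exact self_mem_nhdsWithin
      · exact nhdsWithin_le_nhds ((Filter.tendsto_id.eventually_ne (Ne.symm hqs)).mono fun z hz => hz)
    filter_upwards [hαε, h1, h2] with ε hε hε1 hε2
    exact hε hε1 hε2
  -- continuity of `ε ↦ α (y + ε v)` at `0` within `≠ 0`
  have hlim : Tendsto (fun ε : ℝ => α (y + ε • v)) (𝓝[≠] 0) (𝓝 (α y)) := by
    have hcont : Tendsto (fun ε : ℝ => y + ε • v) (𝓝 0) (𝓝 y) := by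
      have : Continuous (fun ε : ℝ => y + ε • v) := by fun_prop
      simpa using this.tendsto 0
    have hin : ∀ᶠ ε : ℝ in 𝓝 0, y + ε • v ∈ O := hcont (hO.mem_nhds hy)
    have h1 : Tendsto (fun ε : ℝ => y + ε • v) (𝓝[≠] 0) (𝓝[O] y) :=
      tendsto_nhdsWithin_iff.2 ⟨hcont.mono_left nhdsWithin_le_nhds, nhdsWithin_le_nhds hin⟩
    exact ((hαc y hy).tendsto).comp h1
  have hlim0 : Tendsto (fun ε : ℝ => α (y + ε • v)) (𝓝[≠] 0) (𝓝 0) :=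
    (tendsto_congr' hev).2 tendsto_const_nhds
  exact tendsto_nhds_unique hlim hlim0

end Summit.NavierStokesRegularity.NavierStokesRegularity.Theorems.PoloidalWindowDoorLrcModEntireAxisKinematics4

end
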